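import Summits.CriticalPhenomena.PercolationContinuityZ3.Theorems.Transplant.SkelPhiStepINeg
import Summits.CriticalPhenomena.PercolationContinuityZ3.Theorems.Transplant.SkelPhiStepINegFrame
import HarnessLib

/-!
# N1 (the {±1} node), LEVEL 0, file (L0-4d): the PAIRS index set `StepI.indexNP types Sz SMn` — zones over `Sz`, piece-links over an explicit finite set of
# admissible (zone size, width) PAIRS `SMn` (the two-scale ladder uses exactly `{(M_u, n_s), (M_L, n_L)}`; the product `Sz ×ˢ Sn` of `indexN` would contain the
# inadmissible cross pair `(M_L, n_s)` — stmt-g12's located objection 13:04Z, adopted), with `exists_stepI_neg_indexP`, `unpackNP`, `exists_inputsNP_at_center`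

builds on p205010 (kernel theorem, internal audit signed; external expert review pending) — nothing here uses p205010; nothing is claimed about the open node
`SamePDropOfSkeletonNeg`.  Lane `prim-bschramm`, seat `prim-bschramm-p3` (gen 8; design owner); helper file (`--supports stmt-CriticalPhenomena-4575`).
[cite: KozmaNitzan2024, §4 p. 17 (Step I), pp. 19–21 ((21)–(25))] [cite: MartineauTassion2017, §3.3 Lemma 3.7]
-/

noncomputable section

namespace Summit.CriticalPhenomena.PercolationContinuityZ3.Theorems.Transplant

namespace Skelφ

namespace StepI

open MeasureTheory Literature.Probability.Percolation Literature.Probability.LatticeModels SimpleGraph KNLevels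
open scoped Classical

variable {V : Type} {G : SimpleGraph V} {φ : V → Site 2} {types : Finset V}

/-- **The pairs index set**: base vertices × (zone sizes `Sz` | admissible pairs `(M, n) ∈ SMn` × families × signs). [this work] -/
def indexNP (types : Finset V) (Sz : Finset ℕ) (SMn : Finset (ℕ × ℕ)) : Finset (IdxN V) :=
  types ×ˢ ((Sz ×ˢ ({none} : Finset (Option (ℕ × Fin 2 × ℤˣ × ℤˣ)))) ∪
    ((SMn ×ˢ (Finset.univ : Finset (Fin 2 × ℤˣ × ℤˣ))).image fun q => (q.1.1, some (q.1.2, q.2))))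

/-- Zone indices belong to the pairs index set. [folklore] -/
theorem mem_indexNP_none {Sz : Finset ℕ} {SMn : Finset (ℕ × ℕ)} {t : V} (ht : t ∈ types) {M : ℕ} (hM : M ∈ Sz) :
    (t, M, none) ∈ indexNP types Sz SMn := by
  rw [indexNP, Finset.mem_product]
  exact ⟨ht, Finset.mem_union_left _ (Finset.mem_product.2 ⟨hM, Finset.mem_singleton_self _⟩)⟩

/-- Piece-link indices of admissible pairs belong to the pairs index set. [folklore] -/
theorem mem_indexNP_some {Sz : Finset ℕ} {SMn : Finset (ℕ × ℕ)} {t : V} (ht : t ∈ types) {M n : ℕ} (hMn : (M, n) ∈ SMn) (fam : Fin 2) (σ τ : ℤˣ) :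
    (t, M, some (n, fam, σ, τ)) ∈ indexNP types Sz SMn := by
  rw [indexNP, Finset.mem_product]
  refine ⟨ht, Finset.mem_union_right _ ?_⟩
  rw [Finset.mem_image]
  exact ⟨((M, n), fam, σ, τ), Finset.mem_product.2 ⟨hMn, Finset.mem_univ _⟩, rfl⟩

/-- The shape of an index in the pairs index set. [folklore] -/
theorem of_mem_indexNP {Sz : Finset ℕ} {SMn : Finset (ℕ × ℕ)} {i : IdxN V} (hi : i ∈ indexNP types Sz SMn) :
    i.1 ∈ types ∧ ((i.2.1 ∈ Sz ∧ i.2.2 = none) ∨ ∃ q ∈ SMn, i.2.1 = q.1 ∧ ∃ (fam : Fin 2) (σ τ : ℤˣ), i.2.2 = some (q.2, fam, σ, τ)) := by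
  obtain ⟨t, M, og⟩ := i
  rw [indexNP, Finset.mem_product, Finset.mem_union, Finset.mem_product, Finset.mem_singleton, Finset.mem_image] at hi
  obtain ⟨ht, h | ⟨q, hq, hqe⟩⟩ := hi
  · exact ⟨ht, Or.inl h⟩
  · simp only [Prod.mk.injEq] at hqe
    refine ⟨ht, Or.inr ⟨q.1, (Finset.mem_product.1 hq).1, hqe.1.symm, q.2.1, q.2.2.1, q.2.2.2, ?_⟩⟩
    rw [← hqe.2]

/-- **STEP I″ over the pairs index set** (strict inequalities): zone sizes `Sz` above `M₀`, admissible pairs `(M, n)` with `M₀ ≤ M`, `n₁ M ≤ n`.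
[cite: KozmaNitzan2024, §4 p. 17 (Step I)] -/
theorem exists_stepI_neg_indexP [Countable V] [G.LocallyFinite] (hc : G.Preconnected) (hlip : Lip G φ) (hst : Steps G φ)
    (hfr : Frames G φ types) (hκ : CylConn G φ types) {p : unitInterval} (hC : CylSubcritical G φ types p) (hp0 : 0 < (p : ℝ)) (hp1 : (p : ℝ) < 1)
    (hU : ∀ᵐ ω ∂bondPercolation G p, numInfiniteClusters ω ≤ 1) {z : V} (hθ : 0 < theta G z p)
    (hneg : ∀ t ∈ types, ∃ ρ : G ≃g G, ρ t = t ∧ ∀ w, φ (ρ w) - φ t = -(φ w - φ t)) {δ : ℝ} (hδ0 : 0 < δ) (hδ1 : δ < 1) (m₀ : ℕ) :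
    ∃ D : DataN V, m₀ ≤ D.k ∧ 1 ≤ D.k ∧ D.k ≤ D.M₀ ∧ D.R = fatRadius hfr hC ∧ D.Λ = fatSeq hfr hC ∧
      (∀ t ∈ types, ∀ M, D.M₀ ≤ M → ∀ n, D.n₁ M ≤ n → D.EqGeom G φ t M n) ∧
      ∀ (Sz : Finset ℕ) (SMn : Finset (ℕ × ℕ)), (∀ M ∈ Sz, D.M₀ ≤ M) → (∀ q ∈ SMn, D.M₀ ≤ q.1 ∧ D.n₁ q.1 ≤ q.2) →
        ∀ i ∈ indexNP types Sz SMn, 1 - δ < (bondPercolation G p).real (eventN G φ D i) := by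
  obtain ⟨D, h1, h2, h3, h4, h5, hz, he⟩ := exists_stepI_neg hc hlip hst hfr hκ hC hp0 hp1 hU hθ hneg (δ := δ / 2) (by positivity) (by linarith) m₀
  refine ⟨D, h1, h2, h3, h4, h5, fun t ht M hM n hn => (he t ht M hM n hn).1, fun Sz SMn hSz hSMn i hi => ?_⟩
  obtain ⟨ht, hog⟩ := of_mem_indexNP hi
  obtain ⟨t, M, og⟩ := i
  simp only at ht hog
  rcases hog with ⟨hM, rfl⟩ | ⟨q, hq, rfl, fam, σ, τ, rfl⟩
  · have := hz t ht M (hSz M hM); linarith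
  · have := ((he t ht q.1 (hSMn q hq).1 q.2 (hSMn q hq).2).2 fam σ τ); linarith

/-- **Unpacking over the pairs index set at a running density `q`.** [folklore] -/
theorem unpackNP [Countable V] [G.LocallyFinite] (D : DataN V) {Sz : Finset ℕ} {SMn : Finset (ℕ × ℕ)} {q : unitInterval} {δ : ℝ}
    (h : ∀ i ∈ indexNP types Sz SMn, 1 - δ < (bondPercolation G q).real (eventN G φ D i)) {t : V} (ht : t ∈ types) :
    (∀ M ∈ Sz, 1 - δ < (bondPercolation G q).real (UniqZone.zone G (D.Λ t) D.k M)) ∧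
      ∀ Mn ∈ SMn, ∀ (fam : Fin 2) (σ τ : ℤˣ),
        1 - δ < (bondPercolation G q).real (linkIn (regionN G φ D t Mn.1 Mn.2) (D.Λ t D.k) (pieceN G φ D t Mn.1 Mn.2 fam σ τ)) :=
  ⟨fun _ hM => h _ (mem_indexNP_none ht hM), fun Mn hMn fam σ τ => h _ (mem_indexNP_some ht (by exact hMn) fam σ τ)⟩

/-- **The inputs at every vertex, pairs form.** [cite: KozmaNitzan2024, §4 pp. 19–21 ((21)–(25))] -/
theorem exists_inputsNP_at_center [Countable V] [G.LocallyFinite] (hfr : Frames G φ types) {p : unitInterval} (hC : CylSubcritical G φ types p)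
    {D : DataN V} (hD : D.Λ = fatSeq hfr hC) {Sz : Finset ℕ} {SMn : Finset (ℕ × ℕ)} {q : unitInterval} {δ : ℝ}
    (h : ∀ i ∈ indexNP types Sz SMn, 1 - δ < (bondPercolation G q).real (eventN G φ D i)) (c : V) :
    ∃ t ∈ types, (∀ M ∈ Sz, 1 - δ < (bondPercolation G q).real (eventNAt G φ D t c (M, none))) ∧
      ∀ Mn ∈ SMn, ∀ (fam : Fin 2) (σ τ : ℤˣ), 1 - δ < (bondPercolation G q).real (eventNAt G φ D t c (Mn.1, some (Mn.2, fam, σ, τ))) := by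
  obtain ⟨t, ht, α, hαt, hφ⟩ := hfr c
  refine ⟨t, ht, fun M hM => ?_, fun Mn hMn fam σ τ => ?_⟩
  · rw [real_eventNAt_frame hαt hφ hfr hC q hD]; exact h _ (mem_indexNP_none ht hM)
  · rw [real_eventNAt_frame hαt hφ hfr hC q hD]; exact h _ (mem_indexNP_some ht (by exact hMn) fam σ τ)

end StepI

end Skelφ

end Summit.CriticalPhenomena.PercolationContinuityZ3.Theorems.Transplant

end
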